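import Summits.AtomisticToContinuum.Crystallization.Theorems.ExcessDecayLiouvillePhononStabilityCertFrame

/-!
# Near-certificate layer: the three window facts in chart coordinates (stub `stub_certWindow`)

Support file for crux `PhononStability` (stmt-AtomisticToContinuum-9333), line
`contragredient-window-collapse`.  The near certificate is a parametric SOS over box cells in the chart
variables `Ĝᵢⱼ = ⟪A genᵢ, A genⱼ⟫` (6 entries) and `δ̂ = contraOf δ` (3 entries); this file supplies the
three window facts its cells and window multipliers rely on:

1. for every coefficient vector `v : Fin 3 → ℝ`, with `x = Σ vᵢ genᵢ`, `‖A x‖² = vᵀ Ĝ v`, so the cell window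
   `189/200 ‖x‖ ≤ ‖A x‖ ≤ 199/200 ‖x‖` squares to `0.893025 ‖x‖² ≤ vᵀ Ĝ v ≤ 0.990025 ‖x‖²`;
2. `δ = Σ δ̂ᵢ genᵢ`, so `δ̂ᵀ Ĝ δ̂ = ‖A δ‖² ≤ (1/40)² = 1/1600`;
3. `‖δ‖ ≤ (200/189) ‖A δ‖ ≤ 5/189` and Cauchy–Schwarz: `δ̂ᵢ² = ⟪dgenᵢ, δ⟫² ≤ ‖dgenᵢ‖² ‖δ‖² = (M₀⁻¹)ᵢᵢ ‖δ‖²`.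

Pure linear algebra in `ℝ³`. [folklore]
-/

noncomputable section

open scoped BigOperators Classical InnerProductSpace
open Filter Set Function
open Summit.AtomisticToContinuum.Crystallization.Theorems.PhononStabilityNegative
open Literature.MathematicalPhysics.StatisticalMechanics

namespace Summit.AtomisticToContinuum.Crystallization.Theorems.PhononStabilityCWC.Cert

local notation "E3" => EuclideanSpace ℝ (Fin 3)

/-! ## Chart norm identity -/

/-- **chart norm identity:** `‖A (Σ vᵢ genᵢ)‖² = vᵀ Ĝ v`. [folklore] -/
theorem norm_sq_chart (A : E3 →L[ℝ] E3) (v : Fin 3 → ℝ) :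
    ‖A (∑ i, v i • gen i)‖ ^ 2 = ∑ i, ∑ j, v i * ghat A i j * v j := by
  have hz : A (∑ i, v i • gen i) = ∑ i, v i • A (gen i) := by simp [map_sum, map_smul]
  rw [← real_inner_self_eq_norm_sq, hz, sum_inner]
  refine Finset.sum_congr rfl fun i _ => ?_
  rw [inner_sum]
  refine Finset.sum_congr rfl fun j _ => ?_
  rw [real_inner_smul_left, real_inner_smul_right, ghat]
  ring

/-! ## The three window facts -/

/-- **(1) the cell window in the chart:** `0.893025 ‖x‖² ≤ vᵀ Ĝ v ≤ 0.990025 ‖x‖²` for `x = Σ vᵢ genᵢ`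
(`(189/200)² = 893025/10⁶`, `(199/200)² = 990025/10⁶`). [folklore] -/
theorem chart_cellWindow (A : E3 →L[ℝ] E3) (hA : CellWindow A) (v : Fin 3 → ℝ) :
    893025 / 1000000 * ‖∑ i, v i • gen i‖ ^ 2 ≤ ∑ i, ∑ j, v i * ghat A i j * v j ∧
      ∑ i, ∑ j, v i * ghat A i j * v j ≤ 990025 / 1000000 * ‖∑ i, v i • gen i‖ ^ 2 := by
  rw [← norm_sq_chart]
  obtain ⟨h1, h2⟩ := hA (∑ i, v i • gen i)
  have h1' := pow_le_pow_left₀ (by positivity) h1 2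
  have h2' := pow_le_pow_left₀ (norm_nonneg _) h2 2
  constructor
  · calc 893025 / 1000000 * ‖∑ i, v i • gen i‖ ^ 2 = (189 / 200 * ‖∑ i, v i • gen i‖) ^ 2 := by ring
      _ ≤ _ := h1'
  · calc ‖A (∑ i, v i • gen i)‖ ^ 2 ≤ (199 / 200 * ‖∑ i, v i • gen i‖) ^ 2 := h2'
      _ = _ := by ring

/-- **(2) the shift window in the chart:** `δ̂ᵀ Ĝ δ̂ = ‖A δ‖² ≤ 1/1600`. [folklore] -/
theorem chart_shiftWindow (A : E3 →L[ℝ] E3) (δ : E3) (hδ : ShiftWindow A δ) :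
    ∑ i, ∑ j, contraOf δ i * ghat A i j * contraOf δ j ≤ 1 / 1600 := by
  rw [← norm_sq_chart, ← expand_contra δ]
  have h0 : 0 ≤ ‖A δ‖ := norm_nonneg _
  have h := pow_le_pow_left₀ h0 hδ 2
  calc ‖A δ‖ ^ 2 ≤ (1 / 40 : ℝ) ^ 2 := h
    _ = 1 / 1600 := by norm_num

/-- **(3) the shift box in the chart:** `δ̂ᵢ² ≤ (M₀⁻¹)ᵢᵢ (5/189)²`, from `‖δ‖ ≤ (200/189)‖A δ‖ ≤ 5/189`
and Cauchy–Schwarz `⟪dgenᵢ, δ⟫² ≤ ‖dgenᵢ‖² ‖δ‖²`, `‖dgenᵢ‖² = (M₀⁻¹)ᵢᵢ`. [folklore] -/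
theorem chart_shiftBox (A : E3 →L[ℝ] E3) (δ : E3) (hA : CellWindow A) (hδ : ShiftWindow A δ) (i : Fin 3) :
    contraOf δ i ^ 2 ≤ (M0inv i i : ℝ) * (5 / 189) ^ 2 := by
  have hδn : ‖δ‖ ≤ 5 / 189 := by
    have h1 := (hA δ).1
    have h2 : ‖A δ‖ ≤ 1 / 40 := hδ
    linarith
  have hcs : |contraOf δ i| ≤ ‖dgen i‖ * ‖δ‖ := abs_real_inner_le_norm _ _
  have hd : ‖dgen i‖ ^ 2 = (M0inv i i : ℝ) := by rw [← real_inner_self_eq_norm_sq, inner_dgen]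
  have hprod : ‖dgen i‖ * ‖δ‖ ≤ ‖dgen i‖ * (5 / 189) := mul_le_mul_of_nonneg_left hδn (norm_nonneg _)
  have habs : |contraOf δ i| ≤ ‖dgen i‖ * (5 / 189) := hcs.trans hprod
  have hsq : contraOf δ i ^ 2 ≤ (‖dgen i‖ * (5 / 189)) ^ 2 := by
    rw [← sq_abs (contraOf δ i)]
    exact pow_le_pow_left₀ (abs_nonneg _) habs 2
  calc contraOf δ i ^ 2 ≤ (‖dgen i‖ * (5 / 189)) ^ 2 := hsq
    _ = ‖dgen i‖ ^ 2 * (5 / 189) ^ 2 := by ring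
    _ = (M0inv i i : ℝ) * (5 / 189) ^ 2 := by rw [hd]

/-- Anchor of this support file (registered stub of the line skeleton): the three window facts in chart
coordinates — the squared cell window for chart vectors, the squared shift window, and the shift box. [folklore] -/
theorem stub_certWindow : ∀ (A : EuclideanSpace ℝ (Fin 3) →L[ℝ] EuclideanSpace ℝ (Fin 3)) (δ : EuclideanSpace ℝ (Fin 3)), CellWindow A → ShiftWindow A δ → (∀ v : Fin 3 → ℝ, 893025 / 1000000 * ‖∑ i, v i • gen i‖ ^ 2 ≤ ∑ i, ∑ j, v i * ghat A i j * v j ∧ ∑ i, ∑ j, v i * ghat A i j * v j ≤ 990025 / 1000000 * ‖∑ i, v i • gen i‖ ^ 2) ∧ ∑ i, ∑ j, contraOf δ i * ghat A i j * contraOf δ j ≤ 1 / 1600 ∧ ∀ i : Fin 3, contraOf δ i ^ 2 ≤ (M0inv i i : ℝ) * (5 / 189) ^ 2 :=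
  fun A δ hA hδ => ⟨chart_cellWindow A hA, chart_shiftWindow A δ hδ, chart_shiftBox A δ hA hδ⟩

end Summit.AtomisticToContinuum.Crystallization.Theorems.PhononStabilityCWC.Cert

end
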